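import Summits.CriticalPhenomena.CardyFormulaZ2.Theorems.CardyComplexConeParafermionToSLESixFamiliesExplorationCongr
import Literature.Probability.LatticeModels.MedialInterfaceProofs
import Literature.Probability.LatticeModels.InterfaceSLETightness
import Literature.Probability.LatticeModels.DiscreteFaceBoundary

/-!
# Oriented boundary dart clouds: the `θ = 0` core of U′ (reshape r1) and their finiteness

Crux `Summit.CriticalPhenomena.CardyFormulaZ2.Theses.CardyComplexCone.ParafermionToSLESixFamilies`
(stmt-CriticalPhenomena-11389), line `caratheodory-net-slit-uniformity`, registered glue of stub
`stub_carrierEquicontinuity'` (`KoebeShadowSquares → CarrierEquicontinuity'`, Defs §3: `θ`-closeness of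
the ORIENTED labelled boundary dart clouds `bdDarts`). Three proved facts about `bdDarts`:

* **Filaments carry no information** (`medialExploration_congr_innerCorners`, `aobs_congr_innerCorners`):
  the medial exploration of `E` — hence `obs`, `startAngle`, `aobs`, `condObs` — depends on the discrete
  arcs only through the labels of the sites that are corners of INNER faces; sites of `Ω_δ` without an
  incident inner face (one-site-wide corridors, antennae) are frozen too but never read (fields of
  `IsMedialExploration`; corner uniqueness `IsCorner.eq_of_cornerSource_eq_of_cornerTarget_eq_holds`
  for the `start` clause).
* **The dart clouds determine those labels** (`mem_bdDarts_iff`, `eq_of_dart_eq`): a dart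
  `(base point, direction / δ)` determines its corner (the direction fixes the position `k` of the face
  around the vertex, the base point then the vertex), whence the registered `θ = 0` core
  **`aobs_congr_bdDarts`**: same carrier, same nonzero mesh, same oriented labelled clouds ⇒ same
  absolutely anchored observable (`ρ = 1`).
* **Finiteness and non-emptiness** (`bdDarts_finite`, `bdDarts_nonempty`): corners of inner faces are
  sites of the finite `Ω_δ`; each `A`–`B` edge of admissible data borders an inner face and has an
  endpoint on each arc — so the Hausdorff distances in `CarrierEquicontinuity'` compare nonempty bounded
  sets and are never junk.

(The stub itself is refuted, granting `IdentifiedLimit`, by a ROUGH version of the wave-1 mirror-marked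
notch — square-wave notch faces carry all four dart directions of both labels within `θ` of every point,
so the oriented clouds of the two mirror-marked data are `θ`-close while `|Φ′_E/Φ′_{E′}|^{1/3} ≈ 2` at
deep points; recorded in the line file. Nothing here depends on it.)

References: S. Smirnov, C. R. Acad. Sci. Paris 333 (2001), §2; G. Grimmett, *Percolation* (1999), §11.2.
-/

noncomputable section

open scoped Topology NNReal ENNReal BoundedContinuousFunction
open Filter Set MeasureTheory
open Literature.Probability Literature.Probability.LatticeModels Literature.Probability.Percolation
open Literature.Probability.RandomPlanarGeometry

namespace Summit.CriticalPhenomena.CardyFormulaZ2.Cruxes.ParafermionToSLESixFamilies.CaratheodoryNetSlitUniformity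

/-! ## §1 Sides of inner faces -/

/-- Every endpoint of the source edge of a corner `(v, f)` is a corner of `f`. -/
theorem isCorner_of_mem_cornerSource {v f x : Site 2} (hv : LatticeModels.IsCorner v f)
    (hx : x ∈ cornerSource v f) : LatticeModels.IsCorner x f := by
  obtain ⟨a, b, -, hs, -⟩ := exists_cornerSource_eq_cornerTarget_eq v f
  rw [hs, cornerEdge, Sym2.mem_iff] at hx
  rcases hx with rfl | rfl
  · exact hv
  · exact isCorner_cornerNeighbor hv a

/-- Every endpoint of the target edge of a corner `(v, f)` is a corner of `f`. -/
theorem isCorner_of_mem_cornerTarget {v f x : Site 2} (hv : LatticeModels.IsCorner v f)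
    (hx : x ∈ cornerTarget v f) : LatticeModels.IsCorner x f := by
  obtain ⟨a, b, -, -, ht⟩ := exists_cornerSource_eq_cornerTarget_eq v f
  rw [ht, cornerEdge, Sym2.mem_iff] at hx
  rcases hx with rfl | rfl
  · exact hv
  · exact isCorner_cornerNeighbor hv b

/-- The target edge of a corner is a lattice edge. -/
theorem cornerTarget_mem_edgeSet {v f : Site 2} (hv : LatticeModels.IsCorner v f) :
    cornerTarget v f ∈ (zdGraph 2).edgeSet := by
  obtain ⟨a, b, -, -, ht⟩ := exists_cornerSource_eq_cornerTarget_eq v f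
  rw [ht]
  exact cornerEdge_mem_edgeSet_holds hv b

/-! ## §2 The exploration reads the arcs only at inner-face corners -/

/-- Equal discrete domain graphs have the same inner faces. -/
theorem isInnerFace_iff_of_graph {E E' : DiscreteDobrushin}
    (hG : discreteDomainGraph E.Ω E.δ = discreteDomainGraph E'.Ω E'.δ) (f : Site 2) :
    E.IsInnerFace f ↔ E'.IsInnerFace f := by
  unfold DiscreteDobrushin.IsInnerFace
  rw [hG]

section InnerCorners

variable {E E' : DiscreteDobrushin} (hG : discreteDomainGraph E.Ω E.δ = discreteDomainGraph E'.Ω E'.δ)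
  (hA : ∀ v f, LatticeModels.IsCorner v f → E.IsInnerFace f → (v ∈ E.zdArcA ↔ v ∈ E'.zdArcA))
  (hB : ∀ v f, LatticeModels.IsCorner v f → E.IsInnerFace f → (v ∈ E.zdArcB ↔ v ∈ E'.zdArcB))
include hG hA hB

/-- On a side of an inner face the completed configurations of two data with the same discrete domain
graph and the same labels at inner-face corners agree. -/
theorem mem_bcBondConfig_iff_of_innerCorners
    {f : Site 2} (hf : E.IsInnerFace f) {e : Sym2 (Site 2)} (he : ∀ x ∈ e, LatticeModels.IsCorner x f)
    (ω : BondConfig (Site 2)) : e ∈ E.bcBondConfig ω ↔ e ∈ E'.bcBondConfig ω := by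
  simp only [DiscreteDobrushin.mem_bcBondConfig_iff, hG]
  have hA' : (∀ x ∈ e, x ∈ E.zdArcA) ↔ ∀ x ∈ e, x ∈ E'.zdArcA :=
    forall₂_congr fun x hx => hA x f (he x hx) hf
  have hB' : (∀ x ∈ e, x ∉ E.zdArcB) ↔ ∀ x ∈ e, x ∉ E'.zdArcB :=
    forall₂_congr fun x hx => not_congr (hB x f (he x hx) hf)
  rw [hA', hB']

/-- On a side of an inner face, membership in the `A`–`B` edges agrees for two such data. -/
theorem mem_zdABEdges_iff_of_innerCorners
    {f : Site 2} (hf : E.IsInnerFace f) {e : Sym2 (Site 2)} (he : ∀ x ∈ e, LatticeModels.IsCorner x f) :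
    e ∈ E.zdABEdges ↔ e ∈ E'.zdABEdges := by
  simp only [DiscreteDobrushin.mem_zdABEdges_iff, hG]
  have hA' : (∃ x ∈ e, x ∈ E.zdArcA) ↔ ∃ x ∈ e, x ∈ E'.zdArcA :=
    exists_congr fun x => and_congr_right fun hx => hA x f (he x hx) hf
  have hB' : (∃ x ∈ e, x ∈ E.zdArcB) ↔ ∃ x ∈ e, x ∈ E'.zdArcB :=
    exists_congr fun x => and_congr_right fun hx => hB x f (he x hx) hf
  rw [hA', hB']

/-- Transport of `IsMedialExploration` between two data with the same discrete domain graph whose arcs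
agree at the corners of inner faces (one direction). Steps go through inner faces, the turning rule
reads the completed configuration on the middle edge, which is a side of the inner face of the previous
step, the end edges are sides of the inner faces of the first / last step, and the start corner is the
(unique) corner of the first step. -/
theorem isMedialExploration_of_innerCorners
    {ω : BondConfig (Site 2)} {γ : List MedialVertex} (h : IsMedialExploration E ω γ) :
    IsMedialExploration E' ω γ := by
  have hInner : ∀ f, E.IsInnerFace f → E'.IsInnerFace f := fun f hf => (isInnerFace_iff_of_graph hG f).1 hf
  have hStep : ∀ e e', E.IsMedialStep e e' → E'.IsMedialStep e e' := fun e e' ⟨v, f, hc, hf, hs, ht⟩ =>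
    ⟨v, f, hc, hInner f hf, hs, ht⟩
  -- the middle edge of a turn / the last edge: a target edge of a step, hence a side of an inner face
  have hTgt : ∀ e e', [e, e'] <:+: γ → ∃ f, E.IsInnerFace f ∧ (∀ x ∈ e', LatticeModels.IsCorner x f) ∧
      e' ∈ (zdGraph 2).edgeSet := by
    intro e e' hi
    obtain ⟨v, f, hc, hf, -, ht⟩ := h.step e e' hi
    exact ⟨f, hf, fun x hx => isCorner_of_mem_cornerTarget hc (ht ▸ hx), ht ▸ cornerTarget_mem_edgeSet hc⟩
  have hSrc : ∀ e e', [e, e'] <:+: γ → ∃ f, E.IsInnerFace f ∧ ∀ x ∈ e, LatticeModels.IsCorner x f := by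
    intro e e' hi
    obtain ⟨v, f, hc, hf, hs, -⟩ := h.step e e' hi
    exact ⟨f, hf, fun x hx => isCorner_of_mem_cornerSource hc (hs ▸ hx)⟩
  have hsub : ∀ (F : DiscreteDobrushin) ω', F.bcBondConfig ω' ⊆ (zdGraph 2).edgeSet := fun F ω' e he =>
    SimpleGraph.edgeSet_mono ((discreteDomainGraph_le_meshGraph _ _).trans (meshGraph_le_zdGraph _ _))
      (F.bcBondConfig_subset ω' he)
  have hlen := h.one_lt_length
  exact
    { ne_nil := h.ne_nil
      step := fun e e' hi => hStep e e' (h.step e e' hi)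
      turn := by
        intro e₀ e₁ e₂ hi
        obtain ⟨v₁, f₁, v₂, f₂, hc₁, hs₁, ht₁, hc₂, hs₂, ht₂, hturn⟩ := h.turn e₀ e₁ e₂ hi
        have hi₂ : [e₀, e₁] <:+: γ :=
          (List.IsPrefix.isInfix ⟨[e₂], by simp⟩ : [e₀, e₁] <:+: [e₀, e₁, e₂]).trans hi
        obtain ⟨f, hf, he₁, he₁z⟩ := hTgt e₀ e₁ hi₂
        have hbc : e₁ ∈ E.bcBondConfig ω ↔ e₁ ∈ E'.bcBondConfig ω :=
          mem_bcBondConfig_iff_of_innerCorners hG hA hB hf he₁ ω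
        refine ⟨v₁, f₁, v₂, f₂, hc₁, hs₁, ht₁, hc₂, hs₂, ht₂, ?_⟩
        rcases hturn with ⟨hv, hd⟩ | ⟨hff, ho⟩
        · refine Or.inl ⟨hv, ?_⟩
          rw [dualEdge_mem_dualConfig_iff_holds (hsub E' ω) he₁z]
          rw [dualEdge_mem_dualConfig_iff_holds (hsub E ω) he₁z] at hd
          exact fun h' => hd (hbc.2 h')
        · exact Or.inr ⟨hff, hbc.1 ho⟩
      nodup := h.nodup
      head_mem := by
        have hp : [γ[0], γ[1]] <+: γ := prefix_pair_getElem γ hlen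
        obtain ⟨f, hf, he⟩ := hSrc _ _ hp.isInfix
        have hhead : γ.head h.ne_nil = γ[0] := List.head_eq_getElem h.ne_nil
        rw [hhead]
        exact (mem_zdABEdges_iff_of_innerCorners hG hA hB hf he).1 (hhead ▸ h.head_mem)
      getLast_mem := by
        have hlt : γ.length - 2 + 1 < γ.length := by omega
        have hi : [γ[γ.length - 2], γ[γ.length - 2 + 1]] <:+: γ := infix_pair_getElem γ _ hlt
        obtain ⟨f, hf, he, -⟩ := hTgt _ _ hi
        have hlast : γ.getLast h.ne_nil = γ[γ.length - 2 + 1] := by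
          rw [List.getLast_eq_getElem]; congr 1; omega
        rw [hlast]
        exact (mem_zdABEdges_iff_of_innerCorners hG hA hB hf he).1 (hlast ▸ h.getLast_mem)
      head_ne_getLast := h.head_ne_getLast
      start := by
        intro e e' hp
        obtain ⟨v, f, hc, hs, ht, hv⟩ := h.start e e' hp
        obtain ⟨v', f', hc', hf', hs', ht'⟩ := h.step e e' hp.isInfix
        obtain ⟨rfl, rfl⟩ : v = v' ∧ f = f' :=
          IsCorner.eq_of_cornerSource_eq_of_cornerTarget_eq_holds hc hc' (hs.trans hs'.symm)
            (ht.trans ht'.symm)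
        exact ⟨v, f, hc, hs, ht, (hA v f hc hf').1 hv⟩ }

/-- `IsMedialExploration` is invariant between two data with the same discrete domain graph whose arcs
agree at inner-face corners. -/
theorem isMedialExploration_iff_of_innerCorners
    (ω : BondConfig (Site 2)) (γ : List MedialVertex) :
    IsMedialExploration E ω γ ↔ IsMedialExploration E' ω γ := by
  refine ⟨isMedialExploration_of_innerCorners hG hA hB, isMedialExploration_of_innerCorners hG.symm ?_ ?_⟩
  · intro v f hc hf
    exact (hA v f hc ((isInnerFace_iff_of_graph hG f).2 hf)).symm
  · intro v f hc hf
    exact (hB v f hc ((isInnerFace_iff_of_graph hG f).2 hf)).symm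

/-- The medial exploration depends on the arcs only through the labels at inner-face corners (graph
form; the `dite`/`choose` of `medialExploration` is applied to equal predicates). -/
theorem medialExploration_congr_graph_innerCorners :
    medialExploration E = medialExploration E' := by
  classical
  funext ω
  have hpred : IsMedialExploration E ω = IsMedialExploration E' ω :=
    funext fun γ => propext (isMedialExploration_iff_of_innerCorners hG hA hB ω γ)
  unfold medialExploration
  exact congrArg (fun P : List MedialVertex → Prop =>
    if h : ∃! γ : List MedialVertex, P γ then h.exists.choose else ([] : List MedialVertex)) hpred

end InnerCorners

/-- **Registered glue `medialExploration_congr_innerCorners` (filaments carry no information).** Two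
discrete Dobrushin data with the same carrier and mesh whose discrete arcs agree at every corner of
every inner face have the same medial exploration, for every configuration (admissible or not):
labels on sites without an incident inner face are never read. -/
theorem medialExploration_congr_innerCorners : ∀ (E E' : DiscreteDobrushin), E.Ω = E'.Ω → E.δ = E'.δ →
    (∀ v f : Site 2, LatticeModels.IsCorner v f → E.IsInnerFace f → (v ∈ E.zdArcA ↔ v ∈ E'.zdArcA)) →
    (∀ v f : Site 2, LatticeModels.IsCorner v f → E.IsInnerFace f → (v ∈ E.zdArcB ↔ v ∈ E'.zdArcB)) →
    medialExploration E = medialExploration E' := by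
  intro E E' hΩ hδ hA hB
  exact medialExploration_congr_graph_innerCorners (by rw [hΩ, hδ]) hA hB

section Observables

variable {E E' : DiscreteDobrushin} (hΩ : E.Ω = E'.Ω) (hδ : E.δ = E'.δ)
  (hA : ∀ v f : Site 2, LatticeModels.IsCorner v f → E.IsInnerFace f → (v ∈ E.zdArcA ↔ v ∈ E'.zdArcA))
  (hB : ∀ v f : Site 2, LatticeModels.IsCorner v f → E.IsInnerFace f → (v ∈ E.zdArcB ↔ v ∈ E'.zdArcB))
include hΩ hδ hA hB

/-- Same carrier and mesh, same labels at inner-face corners: same observable `obs`. -/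
theorem obs_congr_innerCorners : obs E = obs E' := by
  funext z
  simp only [obs, medialExploration_congr_innerCorners E E' hΩ hδ hA hB, hδ]

/-- Same carrier and mesh, same labels at inner-face corners: same start angle. -/
theorem startAngle_congr_innerCorners : startAngle E = startAngle E' := by
  simp only [startAngle, medialExploration_congr_innerCorners E E' hΩ hδ hA hB, hδ]

/-- Same carrier and mesh, same labels at inner-face corners: same absolutely anchored observable. -/
theorem aobs_congr_innerCorners : aobs E = aobs E' := by
  funext z
  simp only [aobs, obs_congr_innerCorners hΩ hδ hA hB, startAngle_congr_innerCorners hΩ hδ hA hB]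

/-- Same carrier and mesh, same labels at inner-face corners: same conditional inner amplitudes. -/
theorem condObs_congr_innerCorners : condObs E = condObs E' := by
  funext Q ξ z
  simp only [condObs, medialExploration_congr_innerCorners E E' hΩ hδ hA hB, hδ]

end Observables

/-! ## §3 The dart clouds determine the labels at inner-face corners -/

/-- The medial point of the edge at `v` in direction `u`: `meshPoint δ v + meshPoint δ u / 2`. -/
theorem medialPoint_mk_add (δ : ℝ) (v u : Site 2) :
    medialPoint δ s(v, v + u) = meshPoint δ v + meshPoint δ u / 2 := by
  rw [medialPoint_mk, meshPoint_add]
  ring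

/-- The four medial-edge directions `(u_{k+1} - u_k)/2` are pairwise distinct: the direction of a dart
determines the position of its face around its vertex. -/
theorem cornerUnit_dir_injective {k k' : Fin 4}
    (h : Site.toComplex (cornerUnit (k + 1)) - Site.toComplex (cornerUnit k) =
      Site.toComplex (cornerUnit (k' + 1)) - Site.toComplex (cornerUnit k')) : k = k' := by
  fin_cases k <;> fin_cases k' <;> simp_all [cornerUnit, Site.toComplex, Complex.ext_iff] <;> norm_num at h

/-- **Membership in a dart cloud, in coded corners.** A pair lies in `bdDarts E S rev` iff it is the
(possibly reversed) dart of a corner `(v, faceAt v k)` of an inner face with `v ∈ S`; the dart of that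
corner runs from the edge at `v` in direction `k` to the edge in direction `k + 1`. -/
theorem mem_bdDarts_iff (E : DiscreteDobrushin) (S : Set (Site 2)) (rev : Bool) (p : ℂ × ℂ) :
    p ∈ bdDarts E S rev ↔ ∃ (v : Site 2) (k : Fin 4), E.IsInnerFace (faceAt v k) ∧ v ∈ S ∧
      p = (if rev then medialPoint E.δ s(v, v + cornerUnit (k + 1)) else medialPoint E.δ s(v, v + cornerUnit k),
        (if rev then -1 else 1) * (E.δ : ℂ)⁻¹ *
          (medialPoint E.δ s(v, v + cornerUnit (k + 1)) - medialPoint E.δ s(v, v + cornerUnit k))) := by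
  constructor
  · rintro ⟨v, f, hc, hf, hv, rfl⟩
    obtain ⟨k, rfl⟩ := exists_faceAt_of_isCorner hc
    exact ⟨v, k, hf, hv, by rw [cornerSource_faceAt, cornerTarget_faceAt]⟩
  · rintro ⟨v, k, hf, hv, rfl⟩
    exact ⟨v, faceAt v k, isCorner_faceAt v k, hf, hv, by rw [cornerSource_faceAt, cornerTarget_faceAt]⟩

/-- **A dart determines its corner** (at a fixed nonzero mesh and a fixed orientation flag): the
direction component determines `k`, the base point then `v`. -/
theorem eq_of_dart_eq {δ : ℝ} (hδ : δ ≠ 0) (rev : Bool) {v v' : Site 2} {k k' : Fin 4}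
    (h : ((if rev then medialPoint δ s(v, v + cornerUnit (k + 1)) else medialPoint δ s(v, v + cornerUnit k),
        (if rev then -1 else 1) * (δ : ℂ)⁻¹ *
          (medialPoint δ s(v, v + cornerUnit (k + 1)) - medialPoint δ s(v, v + cornerUnit k))) : ℂ × ℂ) =
      (if rev then medialPoint δ s(v', v' + cornerUnit (k' + 1)) else medialPoint δ s(v', v' + cornerUnit k'),
        (if rev then -1 else 1) * (δ : ℂ)⁻¹ *
          (medialPoint δ s(v', v' + cornerUnit (k' + 1)) - medialPoint δ s(v', v' + cornerUnit k')))) :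
    v = v' ∧ k = k' := by
  simp only [medialPoint_mk_add, Prod.mk.injEq] at h
  obtain ⟨h1, h2⟩ := h
  have hδC : (δ : ℂ) ≠ 0 := Complex.ofReal_ne_zero.2 hδ
  have hsign : ((if rev then -1 else 1 : ℂ)) ≠ 0 := by split_ifs <;> norm_num
  -- the direction component: `(u_{k+1} - u_k)/2 = (u_{k'+1} - u_{k'})/2`
  have h2' : meshPoint δ (cornerUnit (k + 1)) - meshPoint δ (cornerUnit k) =
      meshPoint δ (cornerUnit (k' + 1)) - meshPoint δ (cornerUnit k') := by
    have := mul_left_cancel₀ hsign (mul_left_cancel₀ (inv_ne_zero hδC) (by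
      simpa [mul_assoc] using h2))
    linear_combination (2 : ℂ) * this
  have hk : k = k' := by
    apply cornerUnit_dir_injective
    have e1 : ∀ u : Site 2, meshPoint δ u = (δ : ℂ) * Site.toComplex u := fun u => rfl
    simp only [e1, ← mul_sub] at h2'
    exact mul_left_cancel₀ hδC h2'
  subst hk
  refine ⟨DiscreteDobrushin.meshPoint_injective hδ ?_, rfl⟩
  split_ifs at h1 with hr
  · exact add_right_cancel h1
  · exact add_right_cancel h1

/-- **Equal clouds force equal labels at inner-face corners.** If two data of the same nonzero mesh have
the same cloud `bdDarts · S rev = bdDarts · S' rev`, then `(faceAt v k inner in E ∧ v ∈ S)` iff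
`(faceAt v k inner in E' ∧ v ∈ S')`. -/
theorem inner_and_mem_iff_of_bdDarts_eq {E E' : DiscreteDobrushin} {S S' : Set (Site 2)} {rev : Bool}
    (hδ : E.δ = E'.δ) (hδ0 : E.δ ≠ 0) (h : bdDarts E S rev = bdDarts E' S' rev) (v : Site 2) (k : Fin 4) :
    (E.IsInnerFace (faceAt v k) ∧ v ∈ S) ↔ (E'.IsInnerFace (faceAt v k) ∧ v ∈ S') := by
  constructor
  · rintro ⟨hf, hv⟩
    have hp := (mem_bdDarts_iff E S rev _).2 ⟨v, k, hf, hv, rfl⟩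
    rw [h, mem_bdDarts_iff, ← hδ] at hp
    obtain ⟨v', k', hf', hv', hp⟩ := hp
    obtain ⟨rfl, rfl⟩ := eq_of_dart_eq hδ0 rev hp
    exact ⟨hf', hv'⟩
  · rintro ⟨hf, hv⟩
    have hp := (mem_bdDarts_iff E' S' rev _).2 ⟨v, k, hf, hv, rfl⟩
    rw [← h, mem_bdDarts_iff, hδ] at hp
    obtain ⟨v', k', hf', hv', hp⟩ := hp
    obtain ⟨rfl, rfl⟩ := eq_of_dart_eq (hδ ▸ hδ0) rev hp
    exact ⟨hf', hv'⟩

/-- Equal clouds at a common nonzero mesh: the labels agree at every corner of every common inner face. -/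
theorem mem_iff_of_bdDarts_eq {E E' : DiscreteDobrushin} {S S' : Set (Site 2)} {rev : Bool}
    (hδ : E.δ = E'.δ) (hδ0 : E.δ ≠ 0) (h : bdDarts E S rev = bdDarts E' S' rev) {v f : Site 2}
    (hc : LatticeModels.IsCorner v f) (hf : E.IsInnerFace f) (hf' : E'.IsInnerFace f) : v ∈ S ↔ v ∈ S' := by
  obtain ⟨k, rfl⟩ := exists_faceAt_of_isCorner hc
  have key := inner_and_mem_iff_of_bdDarts_eq hδ hδ0 h v k
  constructor
  · exact fun hv => (key.1 ⟨hf, hv⟩).2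
  · exact fun hv => (key.2 ⟨hf', hv⟩).2

/-- **Registered glue `aobs_congr_bdDarts` (the `θ = 0` core of U′ in its dart form).** Two discrete
Dobrushin data with the same carrier, the same nonzero mesh and the same oriented labelled boundary
dart clouds (wired cloud and reversed dual-wired cloud) have the same absolutely anchored observable:
the clouds fix the labels at inner-face corners, and the exploration reads nothing else. -/
theorem aobs_congr_bdDarts : ∀ (E E' : DiscreteDobrushin), E.Ω = E'.Ω → E.δ = E'.δ → E.δ ≠ 0 →
    bdDarts E E.zdArcA false = bdDarts E' E'.zdArcA false →
    bdDarts E E.zdArcB true = bdDarts E' E'.zdArcB true → aobs E = aobs E' := by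
  intro E E' hΩ hδ hδ0 hA hB
  have hG : discreteDomainGraph E.Ω E.δ = discreteDomainGraph E'.Ω E'.δ := by rw [hΩ, hδ]
  refine aobs_congr_innerCorners hΩ hδ (fun v f hc hf => ?_) (fun v f hc hf => ?_)
  · exact mem_iff_of_bdDarts_eq hδ hδ0 hA hc hf ((isInnerFace_iff_of_graph hG f).1 hf)
  · exact mem_iff_of_bdDarts_eq hδ hδ0 hB hc hf ((isInnerFace_iff_of_graph hG f).1 hf)

/-! ## §4 Finiteness and non-emptiness of the clouds -/

/-- **Registered glue `bdDarts_finite`.** For a bounded carrier and a positive mesh every dart cloud is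
finite: it is an image of (a subset of) `Ω_δ × Fin 4`, and `Ω_δ` is finite (`meshDomain_finite`). In
particular the Hausdorff distances of `CarrierEquicontinuity'` compare bounded sets. -/
theorem bdDarts_finite : ∀ (E : DiscreteDobrushin) (S : Set (Site 2)) (rev : Bool),
    Bornology.IsBounded E.Ω → 0 < E.δ → (bdDarts E S rev).Finite := by
  intro E S rev hΩ hδ
  have hfin : ((meshDomain E.Ω E.δ) ×ˢ (Set.univ : Set (Fin 4))).Finite :=
    (meshDomain_finite hΩ hδ).prod Set.finite_univ
  refine (hfin.image fun q : Site 2 × Fin 4 =>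
    ((if rev then medialPoint E.δ s(q.1, q.1 + cornerUnit (q.2 + 1)) else medialPoint E.δ s(q.1, q.1 + cornerUnit q.2),
      (if rev then -1 else 1) * (E.δ : ℂ)⁻¹ *
        (medialPoint E.δ s(q.1, q.1 + cornerUnit (q.2 + 1)) - medialPoint E.δ s(q.1, q.1 + cornerUnit q.2))) :
      ℂ × ℂ)).subset ?_
  intro p hp
  obtain ⟨v, k, hf, -, rfl⟩ := (mem_bdDarts_iff E S rev p).1 hp
  exact ⟨(v, k), ⟨mem_meshDomain_of_isCorner_of_isInnerFace (isCorner_faceAt v k) hf, Set.mem_univ _⟩, rfl⟩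

/-- **Registered glue `bdDarts_nonempty`.** For admissible data both labelled clouds are nonempty: an
`A`–`B` edge exists (`ncard = 2`), borders an inner face (`zdABEdges_inner`) and has an endpoint on each
arc, and each endpoint is a corner of that face. In particular the Hausdorff distances of
`CarrierEquicontinuity'` never take the junk value of an empty operand. -/
theorem bdDarts_nonempty : ∀ (E : DiscreteDobrushin), E.IsZdAdmissible →
    (bdDarts E E.zdArcA false).Nonempty ∧ (bdDarts E E.zdArcB true).Nonempty := by
  intro E hE
  have hne : E.zdABEdges.Nonempty :=
    Set.nonempty_of_ncard_ne_zero (by rw [hE.ncard_zdABEdges_eq_two]; decide)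
  obtain ⟨e, he⟩ := hne
  obtain ⟨f, ⟨hf, hcorn⟩, -⟩ := hE.zdABEdges_inner e he
  obtain ⟨-, ⟨x, hxe, hxA⟩, ⟨y, hye, hyB⟩⟩ := (DiscreteDobrushin.mem_zdABEdges_iff E).1 he
  exact ⟨⟨_, x, f, hcorn x hxe, hf, hxA, rfl⟩, ⟨_, y, f, hcorn y hye, hf, hyB, rfl⟩⟩

end Summit.CriticalPhenomena.CardyFormulaZ2.Cruxes.ParafermionToSLESixFamilies.CaratheodoryNetSlitUniformity

end
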